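import Summits.CriticalPhenomena.CardyFormulaZ2.Theorems.CardyComplexConeDefs
import Literature.Probability.Percolation.Percolation
import Literature.Probability.Percolation.IkhlefPonsaingFirstPassage

/-!
# Stub `stub_ipExact` of line `qkz-strip-boundary-arm` — the honest conditional bridge
(crux `EdgePrecompact`, stmt-CriticalPhenomena-11387)

The registered stub `stub_ipExact` asserts, for bond percolation on `ℤ²` at `p = 1/2`, that in the
diagonal strip `0 ≤ x₀ + x₁ ≤ L` of odd width `L = 2m+1` a site `b` of the level `x₀ + x₁ = 2m = L − 1`
is joined to the wall `{x₀ + x₁ = 0}` by an open path inside the strip with probability EXACTLY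
`ipRatio m = A_V(L) A_V(L+2) / N_8(L+1)²` (`= 1, 3/4, 78/121, 247/425, 210/391, …`).

This is Ikhlef–Ponsaing, *Finite-size left-passage probability in percolation*, J. Stat. Phys. 149
(2012) 10–36 (arXiv:1202.5476), **Proposition 4.7** (homogeneous limit of the inhomogeneous `q`KZ
solution Prop. 4.5, `P_b^{(L)} = χ_{L-1} χ_{L+1} / χ_L²`, evaluated through Di Francesco's symplectic
character identities `χ_{2m}(1,…,1) = 3^{m(m-1)} A_V(2m+1)`, `χ_{2m-1}(1,…,1) = 3^{(m-1)²} N_8(2m)`), read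
through the percolation dictionary of their §2.1–2.2 / §4 (Baxter 1982): the width-`L` Temperley–Lieb
strip at `n = 1` with reflecting walls is bond percolation on the diagonal strip `0 ≤ x₀+x₁ ≤ L` of `ℤ²`
(tiles = edges between consecutive levels, each open with probability `1/2` at the homogeneous point
`z_i = 1`, `w² = −q`), one wall wired and one free; the infinite hull `γ` passes the first site of a
between-double-row cut iff the site at level `1` next to the wired wall is joined, in the lattice that is
wired on the FAR wall, to that far wall — equivalently (reflection `u ↦ L − u` ∘ self-duality at
`p = 1/2`) iff the primal site `b` at level `L − 1` is joined inside the strip to the wired wall `u = 0`,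
and "joined to the wall" never uses the wall's own wiring (stop at the first wall site). So
`P_b^{(L)} = P_{1/2}(wallConn L b)`.

**Status.** A from-scratch Lean proof of Prop. 4.7 is the XL integrable programme (stochastic transfer
matrix on link patterns, its Perron vector as the minimal-degree polynomial solution of the `q`KZ system
— Di Francesco–Zinn-Justin 2005 / de Gier–Pyatov 2007 —, the bilinear passage functional `ρ`, the
recursions Props. 4.1/4.3, degree counting, and the character evaluations); it is not attempted here.
What this file lands is the honest CONDITIONAL BRIDGE:

* `IkhlefPonsaingFirstPassage : Prop` — IP12 Prop. 4.7 stated as a NAMED FACT in the tree's percolation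
  vocabulary (`bondPercolation`, `zdGraph`, `half`, `openConnIn`, `Site`; the strip, the event and the
  three products `A_V(2m+1)`, `A_V(2m+3)`, `N_8(2m+2)` spelled out literally), cited and topic-tagged so
  that the gate relocates it to `Literature/Probability/Percolation/`;
* `ikhlefPonsaingFirstPassage_iff` — the named fact is DEFINITIONALLY the registered signature of
  `stub_ipExact` (`Iff.rfl` against `wallConn`/`diagStrip`/`ipRatio`/`vsasm`/`csscpp` of the Defs module);
* `stub_ipExact_of_IkhlefPonsaing` — the registered bridge stub
  `IkhlefPonsaingFirstPassage → <signature of stub_ipExact>`.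

The unconditional `stub_ipExact` therefore stays OPEN (closed modulo the named fact
`IkhlefPonsaingFirstPassage`).

**Exact check.** The lead verified the identity `P_{1/2}(wallConn (2m+1) b) = ipRatio m` EXACTLY for
`m = 0, 1, 2, 3, 4` (`L = 1, 3, 5, 7, 9`; values `1, 3/4, 78/121, 247/425, 210/391`; 1, 3, 10, 35, 126
transfer states) by an exact rational transfer-matrix computation (stationary vector of the column-to-
column Markov chain of boundary connectivity patterns solved over `ℚ`, left/right half-strips independent
and identically distributed by `x ↦ (x₁, x₀)`), attached to the item as evidence
`ipExact_transfer_matrix.md` (script `strip_exact.py`); a kit job extends the check to `m = 5, 6`.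
-/

namespace Summit.CriticalPhenomena.CardyFormulaZ2.Cruxes.EdgePrecompact.QkzStripBoundaryArm

open MeasureTheory
open scoped BigOperators
open Literature.Probability.LatticeModels Literature.Probability.Percolation

/-- The named fact `IkhlefPonsaingFirstPassage` is, definitionally, the registered signature of
`stub_ipExact` (unfold `wallConn`, `diagStrip`, `ipRatio`, `vsasm`, `csscpp`). -/
theorem ikhlefPonsaingFirstPassage_iff :
    Literature.Probability.Percolation.IkhlefPonsaingFirstPassage ↔ ∀ (m : ℕ) (b : Site 2), b 0 + b 1 = 2 * m →
      (bondPercolation (zdGraph 2) half).real (wallConn (2 * m + 1) b) = ipRatio m :=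
  Iff.rfl

/-- **Bridge (registered stub `stub_ipExact_of_IkhlefPonsaing`).** Ikhlef–Ponsaing's Proposition 4.7,
as the named fact `IkhlefPonsaingFirstPassage`, gives `stub_ipExact` verbatim: for `b₀ + b₁ = 2m`,
`P_{1/2}(wallConn (2m+1) b) = ipRatio m`. -/
theorem stub_ipExact_of_IkhlefPonsaing : Literature.Probability.Percolation.IkhlefPonsaingFirstPassage → ∀ (m : ℕ) (b : Site 2),
    b 0 + b 1 = 2 * m → (bondPercolation (zdGraph 2) half).real (wallConn (2 * m + 1) b) = ipRatio m :=
  fun h m b hb => h m b hb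

end Summit.CriticalPhenomena.CardyFormulaZ2.Cruxes.EdgePrecompact.QkzStripBoundaryArm
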